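import Summits.BirchSwinnertonDyer.BirchSwinnertonDyer.Theorems.KolyvaginRoadThreeZhangTriangulationFinite
import Summits.BirchSwinnertonDyer.BirchSwinnertonDyer.Theorems.KolyvaginRoadThreeZhangInductionOnPos
import HarnessLib

/-!
# Route `KolyvaginRoadThree`, deciding crux `ZhangSharpFrameAtThreeHL` (item stmt-BirchSwinnertonDyer-19574):
# W. Zhang's induction with (A3) DISCHARGED from Kolyvagin-system axioms and NO finiteness hypothesis on relaxed
# Selmer groups (cell `bsd-stepL`, seat `bsd-stepL-zhang3-p1` g8; `--supports stmt-BirchSwinnertonDyer-19574`, helper;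
# re-issue of koly3b g3's `exists_ne_zero_of_zhangInduction_on_of_kolyvaginSystem`, p483236)

HONEST FRAMING. Pure linear algebra over an arbitrary field `F`; nothing about elliptic curves, Heegner points,
level raising or `p = 3` is asserted; every number-theoretic input is an explicitly named HYPOTHESIS SHAPE; 0
definitions, 0 named facts, 0 `sorry`. PARTITION: O2@3 (B10) × A1 × crux 19574 × stub S2
`stub_inductionRankGeThreeAtThree` (its engine-of-Kolyvagin-system kit) — none (composition engine repaired; types
nothing, closes nothing; T7).

THE POINT. koly3b's engine-of-KS (`KolyvaginRoadThreeZhangInductionOfKolyvaginSystem.lean`) — the METHOD engine of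
the crux with the triangulation (A3) no longer posited but derived from Kolyvagin-system axioms at each good level —
carries the binder `hfin : ∀ (n : Finset Q) (S : Set Q) (s : Bool), FiniteDimensional F (SelRel n S s)`: finiteness
of the level-`n` eigen-Selmer group relaxed at EVERY set `S` of admissible primes. In the model of the registered
skeleton v2y of crux 19574 (`SelRel := Method2.SelRelQ W K c`, no local condition above `S`) this is FALSE for
infinite `S` (the cell's finding (R1), zhang3-p1 g5: relaxing at infinitely many good unipotent-admissible places is
infinite-dimensional by Tate's Euler characteristic + Poitou–Tate), so that engine could never be instantiated as
typed; and the only set it is used at, the base locus `B n` of the level-`n` classes (Zhang Def. 8.3: the `q` with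
`loc_q κ(·, n) = 0`), is not known to be finite. The companion file `KolyvaginRoadThreeZhangTriangulationFinite.lean`
PROVES the finiteness of the relaxed space at the base locus (both signs) from the same Kolyvagin-system axioms
(Zhang's own argument, pp. 238–239). Here the two theorems of koly3b's file are re-issued VERBATIM WITHOUT `hfin`:
`exists_ne_zero_of_zhangInduction_on_of_kolyvaginSystem_finite` and `exists_ne_zero_at_bottom_…_finite`. Net list of
inputs of the METHOD engine above the bottom after this file: (A1) rank lowering [= stub A, LANDED p489918], (A2)
congruence transport, (A4) relaxation [tree, `Method2.relaxation_le`], (A5) base case, (A6) parity, the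
Kolyvagin-system axioms of the level-`n` classes (signs, property (1), (8.1) as used), `B n` inside their vanishing
locus, and the level-independent (REC) [tree theorem], (Cheb) ×2, (Supply), (Perf) ∕ (Line) ∕ (Iso) — and NO
finiteness posit. CONDITIONAL on every binder; uniform in `F`; nothing is booked.

References: [cite: WZhang2014, §8.1, Def. 8.3, Lemma 8.1, Lemma 8.2, Lemma 8.4, §9 proof of Thm. 9.1 (pp. 234–242)]
[cite: McCallumLMS1991, Prop. 3.1, Lemma 5.3].
-/

namespace Summit.BirchSwinnertonDyer.Rank1Residual.X11b.Three.Koly.ZhangTriangulation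

open Module Finset

variable {F : Type*} [Field F] {H : Type*} [AddCommGroup H] [Module F H]
variable {P : Type*} {Hv : P → Type*} [∀ v, AddCommGroup (Hv v)] [∀ v, Module F (Hv v)]
variable {ι : Type*} {Q : Type*}

/-- **W. Zhang's induction (Thm. 9.1) on good levels with the triangulation (A3) DERIVED from Kolyvagin-system
axioms and NO finiteness hypothesis on relaxed Selmer groups** — koly3b's
`exists_ne_zero_of_zhangInduction_on_of_kolyvaginSystem` VERBATIM except that the binder
`hfin : ∀ n S s, FiniteDimensional F (SelRel n S s)` (false in the model for infinite `S`) is REMOVED: the finiteness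
of `SelRel n (B n) (¬s)` that the engine `ZhangInductionOnPos.exists_ne_zero_of_zhangInduction_on_pos` reads in its
(A3) input is now supplied by `triangulation_finite` (Zhang's proof of Lemma 8.4 (3)). Hypotheses: (A1), (A2), (A4),
(A5), (A6) relativised to `Good` levels; at every good level the printed membership of `Sel n s` ∕
`SelRel n (B n) s`, `B n` inside the vanishing locus of `κ(·, n)`, the Kolyvagin-system axioms for `κ(·, n)`; and the
level-independent (REC), (Cheb) ×2, (Supply) (per level, for the structure `L n`), (Perf), (Line), (Iso).
Conclusion: a non-zero class `κ m n` at every good even level. CONDITIONAL on every binder; uniform in `F`.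
[cite: WZhang2014, Thm. 9.1, Lemma 8.4, §8.1] [cite: McCallumLMS1991, Prop. 3.1, Lemma 5.3] -/
theorem exists_ne_zero_of_zhangInduction_on_of_kolyvaginSystem_finite [DecidableEq ι] [DecidableEq P]
    [DecidableEq Q] (Good : Finset Q → Prop)
    (Sel : Finset Q → Bool → Submodule F H) (SelRel : Finset Q → Set Q → Bool → Submodule F H)
    (B : Finset Q → Set Q) (κ : Finset ι → Finset Q → H) (m₁ : Finset ι)
    -- Kolyvagin-system data: eigenspaces, local spaces ∕ pairings, level-n Selmer structures, places, signs
    (E : Bool → Submodule F H) (loc : (v : P) → H →ₗ[F] Hv v) (b : (v : P) → Hv v →ₗ[F] Hv v →ₗ[F] F)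
    (L : Finset Q → (v : P) → Submodule F (Hv v)) (pl : ι → P) (plQ : Q → P)
    (Fv Tv : (ℓ : ι) → Submodule F (Hv (pl ℓ))) (ε₀ : Finset Q → Bool)
    -- the level-n Selmer spaces have the printed membership; B n ⊆ vanishing locus (NO finiteness binder)
    (hSel : ∀ n, Good n → ∀ (s : Bool) (x : H), x ∈ Sel n s ↔ x ∈ E s ∧ ∀ v, loc v x ∈ L n v)
    (hSelRel : ∀ n, Good n → ∀ (s : Bool) (x : H),
      x ∈ SelRel n (B n) s ↔ x ∈ E s ∧ ∀ v, v ∉ plQ '' B n → loc v x ∈ L n v)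
    (hB : ∀ n, ∀ q ∈ B n, ∀ m, loc (plQ q) (κ m n) = 0)
    -- the local picture at Kolyvagin primes and global reciprocity
    (hpl : Function.Injective pl)
    (hLF : ∀ n ℓ, L n (pl ℓ) = Fv ℓ)
    (hisoL : ∀ n (v : P), ∀ x ∈ L n v, ∀ y ∈ L n v, b v x y = 0)
    (hisoT : ∀ (ℓ : ι), ∀ x ∈ Tv ℓ, ∀ y ∈ Tv ℓ, b (pl ℓ) x y = 0)
    (hperf : ∀ (ℓ : ι) (s : Bool), ∀ x ∈ E s, ∀ y ∈ E s, loc (pl ℓ) x ∈ Fv ℓ → loc (pl ℓ) x ≠ 0 →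
      loc (pl ℓ) y ∈ Tv ℓ → loc (pl ℓ) y ≠ 0 → b (pl ℓ) (loc (pl ℓ) x) (loc (pl ℓ) y) ≠ 0)
    (hline : ∀ (ℓ : ι) (s : Bool), ∃ e : Hv (pl ℓ), ∀ x ∈ E s, loc (pl ℓ) x ∈ Fv ℓ →
      ∃ a : F, loc (pl ℓ) x = a • e)
    (hrec : ∀ (x y : H) (T : Finset P), (∀ v, v ∉ T → b v (loc v x) (loc v y) = 0) →
      ∑ v ∈ T, b v (loc v x) (loc v y) = 0)
    -- Kolyvagin-system axioms at each good level: signs, property (1) off ∕ on the support, (8.1) as used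
    (hcE : ∀ n, Good n → ∀ m : Finset ι, κ m n ∈ E (ε₀ n ^^ Nat.bodd m.card))
    (hcL : ∀ n, Good n → ∀ (m : Finset ι) (v : P), (∀ ℓ ∈ m, pl ℓ ≠ v) → loc v (κ m n) ∈ L n v)
    (hcT : ∀ n, Good n → ∀ (m : Finset ι), ∀ ℓ ∈ m, loc (pl ℓ) (κ m n) ∈ Tv ℓ)
    (hfs : ∀ n, Good n → ∀ (m : Finset ι) (ℓ : ι), ℓ ∉ m →
      (loc (pl ℓ) (κ (insert ℓ m) n) = 0 ↔ loc (pl ℓ) (κ m n) = 0))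
    -- (Cheb) = Lemma 8.1 (one class; two classes of opposite signs), (Supply) = Lemma 8.2 for the structure L n
    (hCheb1 : ∀ x : H, x ≠ 0 → ∀ S : Finset ι, ∃ ℓ, ℓ ∉ S ∧ loc (pl ℓ) x ≠ 0)
    (hCheb2 : ∀ (s : Bool), ∀ x ∈ E s, ∀ y ∈ E (!s), x ≠ 0 → y ≠ 0 → ∀ S : Finset ι,
      ∃ ℓ, ℓ ∉ S ∧ loc (pl ℓ) x ≠ 0 ∧ loc (pl ℓ) y ≠ 0)
    (hSupply : ∀ n, Good n → ∀ (ℓ : ι) (S : Finset ι), ℓ ∉ S → ∀ s : Bool, ∃ x ∈ E s, x ≠ 0 ∧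
      (∀ v : P, v ≠ pl ℓ → (∀ ℓ' ∈ S, pl ℓ' ≠ v) → loc v x ∈ L n v) ∧ ∀ ℓ' ∈ S, loc (pl ℓ') x ∈ Tv ℓ')
    -- the engine's other inputs, verbatim from `ZhangInductionOnPos`
    (hA1 : ∀ (n : Finset Q) (μ : Bool) (c : H), Good n → c ∈ Sel n μ → c ≠ 0 →
      ∃ q, q ∉ n ∧ Good (insert q n) ∧ c ∉ Sel (insert q n) μ ∧ Sel (insert q n) μ ≤ Sel n μ ∧
        finrank F (Sel (insert q n) μ) + 1 = finrank F (Sel n μ) ∧ Sel (insert q n) (!μ) = Sel n (!μ))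
    (hA2 : ∀ (n : Finset Q) (q₁ q₂ : Q), Good n → Good (insert q₁ n) → Good (insert q₂ (insert q₁ n)) →
      q₁ ∉ n → q₂ ∉ insert q₁ n → q₂ ∉ B (insert q₂ (insert q₁ n)) → ∃ m, κ m n ≠ 0)
    (hA4 : ∀ (n : Finset Q) (q : Q) (S : Set Q) (s : Bool), Good n → Good (insert q n) → q ∉ n → q ∈ S →
      Sel n s ≤ SelRel (insert q n) S s)
    (hA5 : ∀ (n : Finset Q), Good n → Even n.card →
      finrank F (Sel n true) + finrank F (Sel n false) = 1 → κ m₁ n ≠ 0)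
    (hA6 : ∀ (n : Finset Q), Good n → Even n.card → Odd (finrank F (Sel n true) + finrank F (Sel n false))) :
    ∀ (n : Finset Q), Good n → Even n.card → ∃ m, κ m n ≠ 0 := by
  refine ZhangInductionOnPos.exists_ne_zero_of_zhangInduction_on_pos Good Sel SelRel B κ m₁ hA1 hA2
    (fun n hg _ _ hne ↦ ?_) hA4 hA5 hA6
  -- (A3) at the good level n, finiteness included: Lemma 8.4 (1)+(3) for the system κ(·, n), base set plQ '' B n
  have hB' : ∀ v ∈ plQ '' B n, ∀ m : Finset ι, loc v (κ m n) = 0 := by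
    rintro v ⟨q, hq, rfl⟩ m
    exact hB n q hq m
  exact triangulation_finite E loc b (L n) pl Fv Tv (fun m ↦ κ m n) (ε₀ n) (plQ '' B n) (Sel n) (SelRel n (B n))
    (hSel n hg) (hSelRel n hg) hB' hpl (hLF n) (hisoL n) hisoT hperf hline hrec (hcE n hg) (hcL n hg) (hcT n hg)
    (hfs n hg) hCheb1 hCheb2 (hSupply n hg) hne

/-- **At the bottom level** (`n = ∅`, assumed good), NO finiteness hypothesis: under (A1), (A2), (A4), (A5), (A6) on
good levels and the Kolyvagin-system axioms + (REC) ∕ (Cheb) ∕ (Supply) ∕ local picture at every good level, some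
class `κ m ∅` is non-zero — Zhang's Thm. 9.1 `κ ≠ 0` with Lemma 8.4 (incl. the finiteness of the relaxed Selmer group
at the base locus) no longer an input. [cite: WZhang2014, Thm. 9.1 and Lemma 8.4] -/
theorem exists_ne_zero_at_bottom_of_zhangInduction_on_of_kolyvaginSystem_finite [DecidableEq ι] [DecidableEq P]
    [DecidableEq Q] (Good : Finset Q → Prop) (hgood : Good ∅)
    (Sel : Finset Q → Bool → Submodule F H) (SelRel : Finset Q → Set Q → Bool → Submodule F H)
    (B : Finset Q → Set Q) (κ : Finset ι → Finset Q → H) (m₁ : Finset ι)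
    (E : Bool → Submodule F H) (loc : (v : P) → H →ₗ[F] Hv v) (b : (v : P) → Hv v →ₗ[F] Hv v →ₗ[F] F)
    (L : Finset Q → (v : P) → Submodule F (Hv v)) (pl : ι → P) (plQ : Q → P)
    (Fv Tv : (ℓ : ι) → Submodule F (Hv (pl ℓ))) (ε₀ : Finset Q → Bool)
    (hSel : ∀ n, Good n → ∀ (s : Bool) (x : H), x ∈ Sel n s ↔ x ∈ E s ∧ ∀ v, loc v x ∈ L n v)
    (hSelRel : ∀ n, Good n → ∀ (s : Bool) (x : H),
      x ∈ SelRel n (B n) s ↔ x ∈ E s ∧ ∀ v, v ∉ plQ '' B n → loc v x ∈ L n v)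
    (hB : ∀ n, ∀ q ∈ B n, ∀ m, loc (plQ q) (κ m n) = 0)
    (hpl : Function.Injective pl)
    (hLF : ∀ n ℓ, L n (pl ℓ) = Fv ℓ)
    (hisoL : ∀ n (v : P), ∀ x ∈ L n v, ∀ y ∈ L n v, b v x y = 0)
    (hisoT : ∀ (ℓ : ι), ∀ x ∈ Tv ℓ, ∀ y ∈ Tv ℓ, b (pl ℓ) x y = 0)
    (hperf : ∀ (ℓ : ι) (s : Bool), ∀ x ∈ E s, ∀ y ∈ E s, loc (pl ℓ) x ∈ Fv ℓ → loc (pl ℓ) x ≠ 0 →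
      loc (pl ℓ) y ∈ Tv ℓ → loc (pl ℓ) y ≠ 0 → b (pl ℓ) (loc (pl ℓ) x) (loc (pl ℓ) y) ≠ 0)
    (hline : ∀ (ℓ : ι) (s : Bool), ∃ e : Hv (pl ℓ), ∀ x ∈ E s, loc (pl ℓ) x ∈ Fv ℓ →
      ∃ a : F, loc (pl ℓ) x = a • e)
    (hrec : ∀ (x y : H) (T : Finset P), (∀ v, v ∉ T → b v (loc v x) (loc v y) = 0) →
      ∑ v ∈ T, b v (loc v x) (loc v y) = 0)
    (hcE : ∀ n, Good n → ∀ m : Finset ι, κ m n ∈ E (ε₀ n ^^ Nat.bodd m.card))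
    (hcL : ∀ n, Good n → ∀ (m : Finset ι) (v : P), (∀ ℓ ∈ m, pl ℓ ≠ v) → loc v (κ m n) ∈ L n v)
    (hcT : ∀ n, Good n → ∀ (m : Finset ι), ∀ ℓ ∈ m, loc (pl ℓ) (κ m n) ∈ Tv ℓ)
    (hfs : ∀ n, Good n → ∀ (m : Finset ι) (ℓ : ι), ℓ ∉ m →
      (loc (pl ℓ) (κ (insert ℓ m) n) = 0 ↔ loc (pl ℓ) (κ m n) = 0))
    (hCheb1 : ∀ x : H, x ≠ 0 → ∀ S : Finset ι, ∃ ℓ, ℓ ∉ S ∧ loc (pl ℓ) x ≠ 0)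
    (hCheb2 : ∀ (s : Bool), ∀ x ∈ E s, ∀ y ∈ E (!s), x ≠ 0 → y ≠ 0 → ∀ S : Finset ι,
      ∃ ℓ, ℓ ∉ S ∧ loc (pl ℓ) x ≠ 0 ∧ loc (pl ℓ) y ≠ 0)
    (hSupply : ∀ n, Good n → ∀ (ℓ : ι) (S : Finset ι), ℓ ∉ S → ∀ s : Bool, ∃ x ∈ E s, x ≠ 0 ∧
      (∀ v : P, v ≠ pl ℓ → (∀ ℓ' ∈ S, pl ℓ' ≠ v) → loc v x ∈ L n v) ∧ ∀ ℓ' ∈ S, loc (pl ℓ') x ∈ Tv ℓ')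
    (hA1 : ∀ (n : Finset Q) (μ : Bool) (c : H), Good n → c ∈ Sel n μ → c ≠ 0 →
      ∃ q, q ∉ n ∧ Good (insert q n) ∧ c ∉ Sel (insert q n) μ ∧ Sel (insert q n) μ ≤ Sel n μ ∧
        finrank F (Sel (insert q n) μ) + 1 = finrank F (Sel n μ) ∧ Sel (insert q n) (!μ) = Sel n (!μ))
    (hA2 : ∀ (n : Finset Q) (q₁ q₂ : Q), Good n → Good (insert q₁ n) → Good (insert q₂ (insert q₁ n)) →
      q₁ ∉ n → q₂ ∉ insert q₁ n → q₂ ∉ B (insert q₂ (insert q₁ n)) → ∃ m, κ m n ≠ 0)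
    (hA4 : ∀ (n : Finset Q) (q : Q) (S : Set Q) (s : Bool), Good n → Good (insert q n) → q ∉ n → q ∈ S →
      Sel n s ≤ SelRel (insert q n) S s)
    (hA5 : ∀ (n : Finset Q), Good n → Even n.card →
      finrank F (Sel n true) + finrank F (Sel n false) = 1 → κ m₁ n ≠ 0)
    (hA6 : ∀ (n : Finset Q), Good n → Even n.card → Odd (finrank F (Sel n true) + finrank F (Sel n false))) :
    ∃ m, κ m ∅ ≠ 0 :=
  exists_ne_zero_of_zhangInduction_on_of_kolyvaginSystem_finite Good Sel SelRel B κ m₁ E loc b L pl plQ Fv Tv ε₀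
    hSel hSelRel hB hpl hLF hisoL hisoT hperf hline hrec hcE hcL hcT hfs hCheb1 hCheb2 hSupply hA1 hA2 hA4 hA5 hA6 ∅
    hgood (by simp)

/-- **Variant: the Kolyvagin-system axioms asked only at NON-EMPTY good levels** (appended by zhang3-p1 g8 for the S2
re-line of crux 19574, skeleton proposal v3: the structure `Method2.LevelKolyvaginSystem` posits the classes' axioms only
above the bottom level `∅`, where the engine never invokes (A3) — `ZhangInductionOnPos`). Identical to
`exists_ne_zero_of_zhangInduction_on_of_kolyvaginSystem_finite` except that `hcE`, `hcL`, `hcT`, `hfs` and `hSupply`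
carry the extra binder `n.Nonempty`; the proof threads the non-emptiness that the engine supplies at its (A3) call.
[cite: WZhang2014, Thm. 9.1, Lemma 8.4, §8.1] -/
theorem exists_ne_zero_of_zhangInduction_on_of_kolyvaginSystem_finite_pos [DecidableEq ι] [DecidableEq P]
    [DecidableEq Q] (Good : Finset Q → Prop)
    (Sel : Finset Q → Bool → Submodule F H) (SelRel : Finset Q → Set Q → Bool → Submodule F H)
    (B : Finset Q → Set Q) (κ : Finset ι → Finset Q → H) (m₁ : Finset ι)
    (E : Bool → Submodule F H) (loc : (v : P) → H →ₗ[F] Hv v) (b : (v : P) → Hv v →ₗ[F] Hv v →ₗ[F] F)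
    (L : Finset Q → (v : P) → Submodule F (Hv v)) (pl : ι → P) (plQ : Q → P)
    (Fv Tv : (ℓ : ι) → Submodule F (Hv (pl ℓ))) (ε₀ : Finset Q → Bool)
    (hSel : ∀ n, Good n → ∀ (s : Bool) (x : H), x ∈ Sel n s ↔ x ∈ E s ∧ ∀ v, loc v x ∈ L n v)
    (hSelRel : ∀ n, Good n → ∀ (s : Bool) (x : H),
      x ∈ SelRel n (B n) s ↔ x ∈ E s ∧ ∀ v, v ∉ plQ '' B n → loc v x ∈ L n v)
    (hB : ∀ n, ∀ q ∈ B n, ∀ m, loc (plQ q) (κ m n) = 0)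
    (hpl : Function.Injective pl)
    (hLF : ∀ n ℓ, L n (pl ℓ) = Fv ℓ)
    (hisoL : ∀ n (v : P), ∀ x ∈ L n v, ∀ y ∈ L n v, b v x y = 0)
    (hisoT : ∀ (ℓ : ι), ∀ x ∈ Tv ℓ, ∀ y ∈ Tv ℓ, b (pl ℓ) x y = 0)
    (hperf : ∀ (ℓ : ι) (s : Bool), ∀ x ∈ E s, ∀ y ∈ E s, loc (pl ℓ) x ∈ Fv ℓ → loc (pl ℓ) x ≠ 0 →
      loc (pl ℓ) y ∈ Tv ℓ → loc (pl ℓ) y ≠ 0 → b (pl ℓ) (loc (pl ℓ) x) (loc (pl ℓ) y) ≠ 0)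
    (hline : ∀ (ℓ : ι) (s : Bool), ∃ e : Hv (pl ℓ), ∀ x ∈ E s, loc (pl ℓ) x ∈ Fv ℓ →
      ∃ a : F, loc (pl ℓ) x = a • e)
    (hrec : ∀ (x y : H) (T : Finset P), (∀ v, v ∉ T → b v (loc v x) (loc v y) = 0) →
      ∑ v ∈ T, b v (loc v x) (loc v y) = 0)
    -- Kolyvagin-system axioms at each good NON-EMPTY level
    (hcE : ∀ n, Good n → n.Nonempty → ∀ m : Finset ι, κ m n ∈ E (ε₀ n ^^ Nat.bodd m.card))
    (hcL : ∀ n, Good n → n.Nonempty → ∀ (m : Finset ι) (v : P), (∀ ℓ ∈ m, pl ℓ ≠ v) → loc v (κ m n) ∈ L n v)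
    (hcT : ∀ n, Good n → n.Nonempty → ∀ (m : Finset ι), ∀ ℓ ∈ m, loc (pl ℓ) (κ m n) ∈ Tv ℓ)
    (hfs : ∀ n, Good n → n.Nonempty → ∀ (m : Finset ι) (ℓ : ι), ℓ ∉ m →
      (loc (pl ℓ) (κ (insert ℓ m) n) = 0 ↔ loc (pl ℓ) (κ m n) = 0))
    (hCheb1 : ∀ x : H, x ≠ 0 → ∀ S : Finset ι, ∃ ℓ, ℓ ∉ S ∧ loc (pl ℓ) x ≠ 0)
    (hCheb2 : ∀ (s : Bool), ∀ x ∈ E s, ∀ y ∈ E (!s), x ≠ 0 → y ≠ 0 → ∀ S : Finset ι,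
      ∃ ℓ, ℓ ∉ S ∧ loc (pl ℓ) x ≠ 0 ∧ loc (pl ℓ) y ≠ 0)
    (hSupply : ∀ n, Good n → n.Nonempty → ∀ (ℓ : ι) (S : Finset ι), ℓ ∉ S → ∀ s : Bool, ∃ x ∈ E s, x ≠ 0 ∧
      (∀ v : P, v ≠ pl ℓ → (∀ ℓ' ∈ S, pl ℓ' ≠ v) → loc v x ∈ L n v) ∧ ∀ ℓ' ∈ S, loc (pl ℓ') x ∈ Tv ℓ')
    (hA1 : ∀ (n : Finset Q) (μ : Bool) (c : H), Good n → c ∈ Sel n μ → c ≠ 0 →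
      ∃ q, q ∉ n ∧ Good (insert q n) ∧ c ∉ Sel (insert q n) μ ∧ Sel (insert q n) μ ≤ Sel n μ ∧
        finrank F (Sel (insert q n) μ) + 1 = finrank F (Sel n μ) ∧ Sel (insert q n) (!μ) = Sel n (!μ))
    (hA2 : ∀ (n : Finset Q) (q₁ q₂ : Q), Good n → Good (insert q₁ n) → Good (insert q₂ (insert q₁ n)) →
      q₁ ∉ n → q₂ ∉ insert q₁ n → q₂ ∉ B (insert q₂ (insert q₁ n)) → ∃ m, κ m n ≠ 0)
    (hA4 : ∀ (n : Finset Q) (q : Q) (S : Set Q) (s : Bool), Good n → Good (insert q n) → q ∉ n → q ∈ S →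
      Sel n s ≤ SelRel (insert q n) S s)
    (hA5 : ∀ (n : Finset Q), Good n → Even n.card →
      finrank F (Sel n true) + finrank F (Sel n false) = 1 → κ m₁ n ≠ 0)
    (hA6 : ∀ (n : Finset Q), Good n → Even n.card → Odd (finrank F (Sel n true) + finrank F (Sel n false))) :
    ∀ (n : Finset Q), Good n → Even n.card → ∃ m, κ m n ≠ 0 := by
  refine ZhangInductionOnPos.exists_ne_zero_of_zhangInduction_on_pos Good Sel SelRel B κ m₁ hA1 hA2
    (fun n hg hn _ hne ↦ ?_) hA4 hA5 hA6
  have hB' : ∀ v ∈ plQ '' B n, ∀ m : Finset ι, loc v (κ m n) = 0 := by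
    rintro v ⟨q, hq, rfl⟩ m
    exact hB n q hq m
  exact triangulation_finite E loc b (L n) pl Fv Tv (fun m ↦ κ m n) (ε₀ n) (plQ '' B n) (Sel n) (SelRel n (B n))
    (hSel n hg) (hSelRel n hg) hB' hpl (hLF n) (hisoL n) hisoT hperf hline hrec (hcE n hg hn) (hcL n hg hn)
    (hcT n hg hn) (hfs n hg hn) hCheb1 hCheb2 (hSupply n hg hn) hne

end Summit.BirchSwinnertonDyer.Rank1Residual.X11b.Three.Koly.ZhangTriangulation
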